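import Summits.AtomisticToContinuum.FouriersLaw.Theses.BondHeatUncertainty

/-!
# The slack in `LightConeBondHeat`: which single-time bond-heat bounds drive the non-ballistic transfer

Support file for item `stmt-AtomisticToContinuum-9123` (`BondHeatUncertainty.LightConeBondHeat`, (S_lc)) of route
`BondHeatUncertainty`.  The route consumes (S_lc) — the `N`-uniform `√t`-law `V_N(b,t) ≤ A√t` of the equilibrium
single-bond heat variance on the light-cone window `1 ≤ t ≤ a·N` — only through the glue `TransferToNonBallistic`
(`LightConeBondHeat → ExtensiveSnapshotIrreversibility → LinearResponseFTUR → NessUnique → NonBallistic`, item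
stmt-AtomisticToContinuum-9656, proved in `…Theorems.BondHeatUncertaintyTransferToNonBallistic`), and that glue evaluates
(S_lc) at the single time `t = a·N`.  This file determines, sorry-free, exactly which single-time bounds the same transfer
tolerates:

* `conductance_small_of_windowed_bondHeat` — abstract real arithmetic (the TRANSFER INEQUALITY): if along some times
  `τ_N > 0` with `τ_N^{2-θ}/N → ∞` every long chain has a bond `b` with `V N b τ_N ≤ B·τ_N^θ` for ONE exponent `θ < 1`,
  and the fluctuation-theorem uncertainty relation (★) `2G²t² ≤ V N b t·(G t/T² + max(C,0)·N)` holds with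
  `G = D N/(N-1) ≥ 0`, then beyond every `N₀` there is a chain with `D N ≤ ε(N-1)`.  Proof: at `t = τ_N`, `G > ε` forces
  `2ε·t^{2-θ} ≤ max(B,0)·(t/T² + max(C,0)·N/ε)`, impossible once `t^{1-θ}` and `t^{2-θ}/N` are large.
* `tendsto_lightCone_window`, `tendsto_power_window` — the growth condition holds for the light cone `τ_N = a·N` with any
  `θ < 1` (`a^{2-θ}·N^{1-θ} → ∞`), and for the power window `τ_N = a·N^η` whenever `η(2-θ) > 1` (so with the
  Edwards–Wilkinson exponent `θ = 1/2` any window exponent `η > 2/3` still serves — room for the logarithmic / power losses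
  of an almost-linear Lieb–Robinson cone in an open-vs-infinite comparison).
* `conductance_small_of_sublinear` — the light-cone case: `V N b (a·N) ≤ B·N^θ`, `θ < 1`, suffices.  The exponent
  `θ = 1` is exactly the trivial (ballistic) size of `V` (`V_N(b,t) ≤ 2⟨j_b²⟩_T·t²` near `t = 1`, `≍ t` for the
  harmonic member), so the transfer needs precisely "any `N`-uniform gain over ballistic at ONE time of order `N`".
* `nonBallistic_of_windowed_bondHeat` — the route-typed form: the single-time windowed law (objects `C`, `V` verbatim as
  in the route items) + (K) `ExtensiveSnapshotIrreversibility` + (★) `LinearResponseFTUR` ⇒ `NonBallistic`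
  (`NessUnique` carried unused, as in `TransferToNonBallistic`).
* `windowed_bondHeat_of_lightConeBondHeat` — (S_lc) is the case `θ = 1/2`, `τ_N = a·N`, `B = A·a^{1/2}`; composing the
  two re-derives `TransferToNonBallistic` (closing `example`).

So for the NonBallistic rung the item (S_lc) may be replaced by the strictly weaker single-time statement
`∃ θ < 1, B, τ (τ_N > 0, τ_N^{2-θ}/N → ∞), N₀ ∀ N ≥ N₀ ∃ b (b+1<N), V_N(b, τ_N) ≤ B·τ_N^θ` without touching the rest of
the route.  Nothing here closes an item.
-/

noncomputable section

open MeasureTheory Filter Topology Set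

namespace Summit.AtomisticToContinuum.FouriersLaw.Theorems.LightConeBondHeat

open Summit.AtomisticToContinuum.FouriersLaw.Theses.BondHeatUncertainty
open Literature.MathematicalPhysics.KineticTheory.HeatConduction

/-! ### The transfer inequality, abstractly -/

/-- **The transfer inequality.**  Let `θ < 1`, times `τ_N > 0` with `τ_N^{2-θ}/N → ∞`, and suppose every long chain has
a bond `b` with `V N b τ_N ≤ B·τ_N^θ`, while the fluctuation-theorem uncertainty relation
`2 G² t² ≤ V N b t · (G t/T² + max(C,0)·N)` holds with `G = D N/(N-1) ≥ 0` for `N ≥ 2`, every bond and every `t > 0`.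
Then beyond every `N₀` there is a chain with `D N ≤ ε (N - 1)`.  (At `t = τ_N`: if `G > ε` then
`2ε t^{2-θ} ≤ max(B,0)(t/T² + max(C,0) N/ε)`; but `ε t^{2-θ} > max(B,0) t/T²` once `t^{1-θ} ≥ max(B,0)/(εT²) + 1` and
`ε t^{2-θ} > max(B,0) max(C,0) N/ε` once `t^{2-θ}/N ≥ max(B,0) max(C,0)/ε² + 1`.) [folklore] -/
theorem conductance_small_of_windowed_bondHeat
    {V : ℕ → ℕ → ℝ → ℝ} {D : ℕ → ℝ} {τ : ℕ → ℝ} {B θ T C ε : ℝ} {N₀ N₁ : ℕ}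
    (hθ : θ < 1) (hT : 0 < T) (hε : 0 < ε)
    (hτ : ∀ N : ℕ, N₁ ≤ N → 0 < τ N)
    (hgrow : Tendsto (fun N : ℕ => τ N ^ (2 - θ) / (N : ℝ)) atTop atTop)
    (hV : ∀ N : ℕ, N₁ ≤ N → ∃ b : ℕ, b + 1 < N ∧ V N b (τ N) ≤ B * τ N ^ θ)
    (hF : ∀ N : ℕ, 2 ≤ N → 0 ≤ D N ∧ ∀ b : ℕ, b + 1 < N → ∀ t : ℝ, 0 < t →
      2 * (D N / ((N : ℝ) - 1)) ^ 2 * t ^ 2 ≤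
        V N b t * (D N / ((N : ℝ) - 1) * t / T ^ 2 + max C 0 * (N : ℝ))) :
    ∃ N : ℕ, N₀ ≤ N ∧ D N ≤ ε * ((N : ℝ) - 1) := by
  -- constants
  set B' : ℝ := max B 0 with hB'
  set C' : ℝ := max C 0 with hC'
  have hB'0 : 0 ≤ B' := le_max_right _ _
  have hC'0 : 0 ≤ C' := le_max_right _ _
  have h1θ : 0 < 1 - θ := by linarith
  have h2θ : 0 < 2 - θ := by linarith
  -- thresholds
  set K₁ : ℝ := B' / (ε * T ^ 2) with hK₁
  have hK₁0 : 0 ≤ K₁ := by positivity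
  set K₂ : ℝ := B' * C' / ε ^ 2 + 1 with hK₂
  -- a real X with X^{1-θ} = K₁ + 1
  set X : ℝ := (K₁ + 1) ^ (1 - θ)⁻¹ with hX
  have hX0 : 0 ≤ X := Real.rpow_nonneg (by linarith) _
  have hXpow : X ^ (1 - θ) = K₁ + 1 := by
    rw [hX]
    exact Real.rpow_inv_rpow (by linarith) h1θ.ne'
  -- eventually τ^{2-θ}/N ≥ K₂ and ≥ 1
  obtain ⟨M₂, hM₂⟩ := Filter.tendsto_atTop_atTop.1 hgrow K₂
  obtain ⟨M₃, hM₃⟩ := Filter.tendsto_atTop_atTop.1 hgrow 1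
  obtain ⟨M₄, hM₄⟩ := exists_nat_ge (X ^ (2 - θ))
  -- choose N
  set N : ℕ := max (max (max N₀ N₁) (max 2 M₂)) (max M₃ M₄) with hN
  have hNN₀ : N₀ ≤ N := by omega
  have hNN₁ : N₁ ≤ N := by omega
  have hN2 : 2 ≤ N := by omega
  have hNM₂ : M₂ ≤ N := by omega
  have hNM₃ : M₃ ≤ N := by omega
  have hNM₄ : M₄ ≤ N := by omega
  refine ⟨N, hNN₀, ?_⟩
  have hN2r : (2 : ℝ) ≤ (N : ℝ) := by exact_mod_cast hN2
  have hNpos : (0 : ℝ) < N := by linarith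
  have hNm1 : (0 : ℝ) < (N : ℝ) - 1 := by linarith
  -- the data at N
  obtain ⟨hD0, hFN⟩ := hF N hN2
  obtain ⟨b, hb, hVb⟩ := hV N hNN₁
  set t : ℝ := τ N with ht
  have ht0 : 0 < t := hτ N hNN₁
  -- growth facts at N
  have hg₂ : K₂ ≤ t ^ (2 - θ) / (N : ℝ) := hM₂ N hNM₂
  have hg₃ : (1 : ℝ) ≤ t ^ (2 - θ) / (N : ℝ) := hM₃ N hNM₃
  have hg₂' : K₂ * (N : ℝ) ≤ t ^ (2 - θ) := (le_div_iff₀ hNpos).1 hg₂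
  have hg₃' : (N : ℝ) ≤ t ^ (2 - θ) := by
    have := (le_div_iff₀ hNpos).1 hg₃
    linarith
  -- t ≥ X, hence t^{1-θ} ≥ K₁ + 1
  have hXt : X ≤ t := by
    have h1 : X ^ (2 - θ) ≤ t ^ (2 - θ) :=
      (hM₄.trans (by exact_mod_cast hNM₄)).trans hg₃'
    exact (Real.rpow_le_rpow_iff hX0 ht0.le h2θ).1 h1
  have ht1θ : K₁ + 1 ≤ t ^ (1 - θ) := by
    rw [← hXpow]
    exact Real.rpow_le_rpow hX0 hXt h1θ.le
  -- power algebra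
  have htθ0 : 0 < t ^ θ := Real.rpow_pos_of_pos ht0 θ
  have ht2θ0 : 0 < t ^ (2 - θ) := Real.rpow_pos_of_pos ht0 (2 - θ)
  have hsplit2 : t ^ 2 = t ^ θ * t ^ (2 - θ) := by
    rw [← Real.rpow_add ht0, ← Real.rpow_two]
    norm_num
  have hsplit1 : t ^ (2 - θ) = t ^ (1 - θ) * t := by
    have : (2 : ℝ) - θ = (1 - θ) + 1 := by ring
    rw [this, Real.rpow_add ht0, Real.rpow_one]
  -- the conductance
  set G : ℝ := D N / ((N : ℝ) - 1) with hG
  have hG0 : 0 ≤ G := div_nonneg hD0 hNm1.le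
  suffices hGε : G ≤ ε by
    rw [hG] at hGε
    exact (div_le_iff₀ hNm1).1 hGε
  by_contra hcon
  push Not at hcon
  have hGpos : 0 < G := hε.trans hcon
  -- (★) at t = τ_N with K = C' N, combined with the windowed bound
  have h1 : 2 * G ^ 2 * t ^ 2 ≤ V N b t * (G * t / T ^ 2 + C' * (N : ℝ)) := hFN b hb t ht0
  have hfac : 0 ≤ G * t / T ^ 2 + C' * (N : ℝ) := by positivity
  have h2 : V N b t ≤ B' * t ^ θ :=
    hVb.trans (mul_le_mul_of_nonneg_right (le_max_left _ _) htθ0.le)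
  have h3 : 2 * G ^ 2 * t ^ 2 ≤ B' * t ^ θ * (G * t / T ^ 2 + C' * (N : ℝ)) :=
    h1.trans (mul_le_mul_of_nonneg_right h2 hfac)
  -- use ε < G twice
  have h5 : 2 * ε * G * t ^ 2 ≤ 2 * G ^ 2 * t ^ 2 := by
    have hεG : ε * G ≤ G * G := mul_le_mul_of_nonneg_right hcon.le hG0
    have hnn : 0 ≤ 2 * t ^ 2 := by positivity
    nlinarith [mul_le_mul_of_nonneg_left hεG hnn]
  have h6 : G * t / T ^ 2 + C' * (N : ℝ) ≤ G * (t / T ^ 2 + C' * (N : ℝ) / ε) := by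
    have h1le : 1 ≤ G / ε := (one_le_div hε).2 hcon.le
    have hC'le : C' * (N : ℝ) ≤ C' * (N : ℝ) * (G / ε) :=
      le_mul_of_one_le_right (by positivity) h1le
    have : G * (t / T ^ 2 + C' * (N : ℝ) / ε) = G * t / T ^ 2 + C' * (N : ℝ) * (G / ε) := by ring
    rw [this]
    linarith
  have h7 : 2 * ε * G * t ^ 2 ≤ G * (B' * t ^ θ * (t / T ^ 2 + C' * (N : ℝ) / ε)) := by
    calc 2 * ε * G * t ^ 2 ≤ B' * t ^ θ * (G * t / T ^ 2 + C' * (N : ℝ)) := h5.trans h3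
      _ ≤ B' * t ^ θ * (G * (t / T ^ 2 + C' * (N : ℝ) / ε)) :=
          mul_le_mul_of_nonneg_left h6 (mul_nonneg hB'0 htθ0.le)
      _ = G * (B' * t ^ θ * (t / T ^ 2 + C' * (N : ℝ) / ε)) := by ring
  -- divide by G > 0
  have h8 : 2 * ε * t ^ 2 ≤ B' * t ^ θ * (t / T ^ 2 + C' * (N : ℝ) / ε) := by
    have h7' : (2 * ε * t ^ 2) * G ≤ (B' * t ^ θ * (t / T ^ 2 + C' * (N : ℝ) / ε)) * G := by
      calc (2 * ε * t ^ 2) * G = 2 * ε * G * t ^ 2 := by ring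
        _ ≤ G * (B' * t ^ θ * (t / T ^ 2 + C' * (N : ℝ) / ε)) := h7
        _ = (B' * t ^ θ * (t / T ^ 2 + C' * (N : ℝ) / ε)) * G := by ring
    exact le_of_mul_le_mul_right h7' hGpos
  -- split t² = t^θ t^{2-θ} and cancel t^θ
  have h9 : 2 * ε * t ^ (2 - θ) ≤ B' * (t / T ^ 2 + C' * (N : ℝ) / ε) := by
    have h8' : (2 * ε * t ^ (2 - θ)) * t ^ θ ≤ (B' * (t / T ^ 2 + C' * (N : ℝ) / ε)) * t ^ θ := by
      calc (2 * ε * t ^ (2 - θ)) * t ^ θ = 2 * ε * (t ^ θ * t ^ (2 - θ)) := by ring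
        _ = 2 * ε * t ^ 2 := by rw [← hsplit2]
        _ ≤ B' * t ^ θ * (t / T ^ 2 + C' * (N : ℝ) / ε) := h8
        _ = (B' * (t / T ^ 2 + C' * (N : ℝ) / ε)) * t ^ θ := by ring
    exact le_of_mul_le_mul_right h8' htθ0
  -- lower bounds for ε t^{2-θ}
  have hT2 : 0 < T ^ 2 := by positivity
  have h10 : B' * (t / T ^ 2) < ε * t ^ (2 - θ) := by
    -- ε t^{2-θ} = ε t^{1-θ} t ≥ ε (K₁ + 1) t = B' t/T² + ε t
    have hK₁' : ε * (K₁ + 1) * t ≤ ε * t ^ (1 - θ) * t := by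
      have := mul_le_mul_of_nonneg_left ht1θ hε.le
      exact mul_le_mul_of_nonneg_right this ht0.le
    have hK₁'' : ε * (K₁ + 1) * t = B' * (t / T ^ 2) + ε * t := by
      rw [hK₁]; field_simp
    have hεt : 0 < ε * t := mul_pos hε ht0
    calc B' * (t / T ^ 2) < B' * (t / T ^ 2) + ε * t := by linarith
      _ = ε * (K₁ + 1) * t := hK₁''.symm
      _ ≤ ε * t ^ (1 - θ) * t := hK₁'
      _ = ε * t ^ (2 - θ) := by rw [hsplit1]; ring
  have h11 : B' * (C' * (N : ℝ) / ε) < ε * t ^ (2 - θ) := by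
    -- ε t^{2-θ} ≥ ε K₂ N = B' C' N/ε + ε N
    have hK₂' : ε * (K₂ * (N : ℝ)) ≤ ε * t ^ (2 - θ) := mul_le_mul_of_nonneg_left hg₂' hε.le
    have hK₂'' : ε * (K₂ * (N : ℝ)) = B' * (C' * (N : ℝ) / ε) + ε * (N : ℝ) := by
      rw [hK₂]; field_simp
    have hεN : 0 < ε * (N : ℝ) := mul_pos hε hNpos
    calc B' * (C' * (N : ℝ) / ε) < B' * (C' * (N : ℝ) / ε) + ε * (N : ℝ) := by linarith
      _ = ε * (K₂ * (N : ℝ)) := hK₂''.symm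
      _ ≤ ε * t ^ (2 - θ) := hK₂'
  -- contradiction
  have h12 : B' * (t / T ^ 2 + C' * (N : ℝ) / ε) < 2 * ε * t ^ (2 - θ) := by
    calc B' * (t / T ^ 2 + C' * (N : ℝ) / ε) = B' * (t / T ^ 2) + B' * (C' * (N : ℝ) / ε) := by ring
      _ < ε * t ^ (2 - θ) + ε * t ^ (2 - θ) := add_lt_add h10 h11
      _ = 2 * ε * t ^ (2 - θ) := by ring
  linarith

/-! ### The growth condition for the light cone and for power windows -/

/-- The light-cone window `τ_N = a·N` (`a > 0`) satisfies the growth condition of the transfer inequality for every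
exponent `θ < 1`: `(a·N)^{2-θ}/N = a^{2-θ}·N^{1-θ} → ∞`. [folklore] -/
theorem tendsto_lightCone_window {a θ : ℝ} (ha : 0 < a) (hθ : θ < 1) :
    Tendsto (fun N : ℕ => (a * (N : ℝ)) ^ (2 - θ) / (N : ℝ)) atTop atTop := by
  have h1θ : 0 < 1 - θ := by linarith
  have hlim : Tendsto (fun N : ℕ => a ^ (2 - θ) * (N : ℝ) ^ (1 - θ)) atTop atTop :=
    ((tendsto_rpow_atTop h1θ).comp tendsto_natCast_atTop_atTop).const_mul_atTop (Real.rpow_pos_of_pos ha _)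
  refine hlim.congr' ?_
  filter_upwards [Filter.eventually_gt_atTop 0] with N hN
  have hN' : (0 : ℝ) < (N : ℝ) := by exact_mod_cast hN
  rw [Real.mul_rpow ha.le hN'.le, eq_div_iff hN'.ne']
  have : (N : ℝ) ^ (2 - θ) = (N : ℝ) ^ (1 - θ) * (N : ℝ) := by
    have h : (2 : ℝ) - θ = (1 - θ) + 1 := by ring
    rw [h, Real.rpow_add hN', Real.rpow_one]
  rw [this]; ring

/-- Power windows `τ_N = a·N^η` (`a > 0`): the growth condition of the transfer inequality holds as soon as
`η(2-θ) > 1`, since `(a·N^η)^{2-θ}/N = a^{2-θ}·N^{η(2-θ)-1}`.  With the Edwards–Wilkinson exponent `θ = 1/2` every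
window exponent `η > 2/3` qualifies. [folklore] -/
theorem tendsto_power_window {a θ η : ℝ} (ha : 0 < a) (hηθ : 1 < η * (2 - θ)) :
    Tendsto (fun N : ℕ => (a * (N : ℝ) ^ η) ^ (2 - θ) / (N : ℝ)) atTop atTop := by
  have hpos : 0 < η * (2 - θ) - 1 := by linarith
  have hlim : Tendsto (fun N : ℕ => a ^ (2 - θ) * (N : ℝ) ^ (η * (2 - θ) - 1)) atTop atTop :=
    ((tendsto_rpow_atTop hpos).comp tendsto_natCast_atTop_atTop).const_mul_atTop (Real.rpow_pos_of_pos ha _)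
  refine hlim.congr' ?_
  filter_upwards [Filter.eventually_gt_atTop 0] with N hN
  have hN' : (0 : ℝ) < (N : ℝ) := by exact_mod_cast hN
  have hNη : 0 ≤ (N : ℝ) ^ η := Real.rpow_nonneg hN'.le _
  rw [Real.mul_rpow ha.le hNη, ← Real.rpow_mul hN'.le, eq_div_iff hN'.ne']
  have : (N : ℝ) ^ (η * (2 - θ)) = (N : ℝ) ^ (η * (2 - θ) - 1) * (N : ℝ) := by
    have h : η * (2 - θ) = (η * (2 - θ) - 1) + 1 := by ring
    rw [h, Real.rpow_add hN', Real.rpow_one]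
    ring_nf
  rw [this]; ring

/-- **Sublinear light-cone transfer.**  If `V N b (a·N) ≤ B·N^θ` for some bond `b` of every long chain, with a fixed
exponent `θ < 1` and slope `a > 0`, and (★) holds as in `conductance_small_of_windowed_bondHeat`, then beyond every `N₀`
there is a chain with `D N ≤ ε (N - 1)` (quantitatively `G_N = O(N^{-(1-θ)/2})`).  The light-cone case `τ_N = a·N` of
the transfer inequality, with `B·N^θ = (B·a^{-θ})·(a·N)^θ`. [folklore] -/
theorem conductance_small_of_sublinear
    {V : ℕ → ℕ → ℝ → ℝ} {D : ℕ → ℝ} {B a θ T C ε : ℝ} {N₀ N₁ : ℕ}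
    (ha : 0 < a) (hθ : θ < 1) (hT : 0 < T) (hε : 0 < ε)
    (hV : ∀ N : ℕ, N₁ ≤ N → ∃ b : ℕ, b + 1 < N ∧ V N b (a * (N : ℝ)) ≤ B * (N : ℝ) ^ θ)
    (hF : ∀ N : ℕ, 2 ≤ N → 0 ≤ D N ∧ ∀ b : ℕ, b + 1 < N → ∀ t : ℝ, 0 < t →
      2 * (D N / ((N : ℝ) - 1)) ^ 2 * t ^ 2 ≤
        V N b t * (D N / ((N : ℝ) - 1) * t / T ^ 2 + max C 0 * (N : ℝ))) :
    ∃ N : ℕ, N₀ ≤ N ∧ D N ≤ ε * ((N : ℝ) - 1) := by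
  have haθ : 0 < a ^ θ := Real.rpow_pos_of_pos ha θ
  refine conductance_small_of_windowed_bondHeat (τ := fun N => a * (N : ℝ)) (B := max B 0 * (a ^ θ)⁻¹)
    (N₁ := max N₁ 1) hθ hT hε (fun N hN => ?_) (tendsto_lightCone_window ha hθ) (fun N hN => ?_) hF
  · have h1 : 1 ≤ N := le_trans (le_max_right _ _) hN
    have : (0 : ℝ) < (N : ℝ) := by exact_mod_cast h1
    exact mul_pos ha this
  · have h1 : 1 ≤ N := le_trans (le_max_right _ _) hN
    have hN0 : (0 : ℝ) < (N : ℝ) := by exact_mod_cast h1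
    obtain ⟨b, hb, hVb⟩ := hV N (le_trans (le_max_left _ _) hN)
    refine ⟨b, hb, hVb.trans ?_⟩
    have hNθ : 0 ≤ (N : ℝ) ^ θ := Real.rpow_nonneg hN0.le _
    have e : max B 0 * (a ^ θ)⁻¹ * (a * (N : ℝ)) ^ θ = max B 0 * (N : ℝ) ^ θ := by
      rw [Real.mul_rpow ha.le hN0.le]
      field_simp
    rw [e]
    exact mul_le_mul_of_nonneg_right (le_max_left _ _) hNθ

/-! ### Route-typed forms -/

/-- **Single-time windowed bond heat ⇒ `NonBallistic`, through (K) and (★).**  Suppose that for the pinned anharmonic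
chain (all parameters `> 0`) and every `T > 0` there are an exponent `θ < 1`, a constant `B`, times `τ_N > 0` with
`τ_N^{2-θ}/N → ∞`, and `N₀`, such that every chain of length `N ≥ N₀` has a bond `b` (`b + 1 < N`) whose equilibrium
bond-heat variance at the single time `τ_N` satisfies `V_N(b, τ_N) ≤ B·τ_N^θ` (`C`, `V` verbatim as in the route items
(S)/(S_lc)).  Then `ExtensiveSnapshotIrreversibility → LinearResponseFTUR → NessUnique → NonBallistic`: evaluate (★) at
`t = τ_N` with `K = max(C,0)·N` and apply the transfer inequality.  The item `LightConeBondHeat` is the case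
`θ = 1/2`, `τ_N = a·N` (`windowed_bondHeat_of_lightConeBondHeat`). [folklore] -/
theorem nonBallistic_of_windowed_bondHeat
    (hS : ∀ ω₂ lam β γ : ℝ, 0 < ω₂ → 0 < lam → 0 < β → 0 < γ → ∀ T : ℝ, 0 < T →
      (let P := pinnedChain ω₂ lam β γ
       let C : ℕ → ℕ → ℝ → ℝ := fun N b s => if h : b < N then ∫ z, P.bondCurrent N ⟨b, h⟩ z *
         (∫ y, P.bondCurrent N ⟨b, h⟩ y ∂(P.transitionKernel N T T s.toNNReal z)) ∂(P.gibbsMeasure N T) else 0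
       let V : ℕ → ℕ → ℝ → ℝ := fun N b t => 2 * ∫ s in (0 : ℝ)..t, (t - s) * C N b s
       ∃ θ B : ℝ, ∃ τ : ℕ → ℝ, θ < 1 ∧ Tendsto (fun N : ℕ => τ N ^ (2 - θ) / (N : ℝ)) atTop atTop ∧
         ∃ N₀ : ℕ, ∀ N : ℕ, N₀ ≤ N → 0 < τ N ∧ ∃ b : ℕ, b + 1 < N ∧ V N b (τ N) ≤ B * τ N ^ θ)) :
    ExtensiveSnapshotIrreversibility → LinearResponseFTUR → NessUnique → NonBallistic := by
  intro hK hF _hU ω₂ lam β γ hω hl hβ hγ huniq μ hμ T hT D hD ε hε N₀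
  -- the windowed single-time bound
  have hS' := hS ω₂ lam β γ hω hl hβ hγ T hT
  simp only [] at hS'
  obtain ⟨θ, B, τ, hθ, hgrow, N₁, hN₁⟩ := hS'
  -- snapshot irreversibility constant
  obtain ⟨C, hC⟩ := hK ω₂ lam β γ hω hl hβ hγ huniq μ hμ T hT
  -- the fluctuation-theorem uncertainty relation
  have hF' := hF ω₂ lam β γ hω hl hβ hγ huniq μ hμ T hT D hD
  simp only [] at hF'
  refine conductance_small_of_windowed_bondHeat
    (V := fun N b t => 2 * ∫ s in (0 : ℝ)..t, (t - s) *
      (if h : b < N then ∫ z, (pinnedChain ω₂ lam β γ).bondCurrent N ⟨b, h⟩ z *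
        (∫ y, (pinnedChain ω₂ lam β γ).bondCurrent N ⟨b, h⟩ y
          ∂((pinnedChain ω₂ lam β γ).transitionKernel N T T s.toNNReal z))
        ∂((pinnedChain ω₂ lam β γ).gibbsMeasure N T) else 0))
    (C := C) hθ hT hε (fun N hN => (hN₁ N hN).1) hgrow (fun N hN => (hN₁ N hN).2) (fun N hN => ?_)
  obtain ⟨hD0, hb⟩ := hF' N hN
  refine ⟨hD0, fun b hb' t ht => hb b hb' t ht (max C 0 * (N : ℝ)) (by positivity) ?_⟩
  filter_upwards [hC N] with δ hδ
  refine hδ.trans (ENNReal.ofReal_le_ofReal ?_)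
  have hδ2 : 0 ≤ (N : ℝ) * δ ^ 2 := by positivity
  nlinarith [le_max_left C 0, hδ2]

/-- **(S_lc) is the case `θ = 1/2`, `τ_N = a·N` of the single-time windowed law.**  `LightConeBondHeat` gives, at the
right end `t = a·N` of its window (admissible once `N ≥ 1/a`), `V_N(b, a·N) ≤ A√(a·N) = A·(a·N)^{1/2}`, and
`(a·N)^{3/2}/N → ∞`. [folklore] -/
theorem windowed_bondHeat_of_lightConeBondHeat (hLC : LightConeBondHeat) :
    ∀ ω₂ lam β γ : ℝ, 0 < ω₂ → 0 < lam → 0 < β → 0 < γ → ∀ T : ℝ, 0 < T →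
      (let P := pinnedChain ω₂ lam β γ
       let C : ℕ → ℕ → ℝ → ℝ := fun N b s => if h : b < N then ∫ z, P.bondCurrent N ⟨b, h⟩ z *
         (∫ y, P.bondCurrent N ⟨b, h⟩ y ∂(P.transitionKernel N T T s.toNNReal z)) ∂(P.gibbsMeasure N T) else 0
       let V : ℕ → ℕ → ℝ → ℝ := fun N b t => 2 * ∫ s in (0 : ℝ)..t, (t - s) * C N b s
       ∃ θ B : ℝ, ∃ τ : ℕ → ℝ, θ < 1 ∧ Tendsto (fun N : ℕ => τ N ^ (2 - θ) / (N : ℝ)) atTop atTop ∧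
         ∃ N₀ : ℕ, ∀ N : ℕ, N₀ ≤ N → 0 < τ N ∧ ∃ b : ℕ, b + 1 < N ∧ V N b (τ N) ≤ B * τ N ^ θ) := by
  intro ω₂ lam β γ hω hl hβ hγ T hT
  have hLC' := hLC ω₂ lam β γ hω hl hβ hγ T hT
  simp only [] at hLC' ⊢
  obtain ⟨A, a, ha, N₀, hN₀⟩ := hLC'
  obtain ⟨M₁, hM₁⟩ := exists_nat_ge a⁻¹
  have hgrow := tendsto_lightCone_window (θ := 1 / 2) ha (by norm_num)
  refine ⟨1 / 2, A, fun N => a * (N : ℝ), by norm_num, hgrow, max N₀ M₁, fun N hN => ?_⟩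
  have hNM₁ : M₁ ≤ N := le_trans (le_max_right _ _) hN
  have hainv : a⁻¹ ≤ (N : ℝ) := hM₁.trans (by exact_mod_cast hNM₁)
  have ht1 : 1 ≤ a * (N : ℝ) := by
    have : a * a⁻¹ ≤ a * (N : ℝ) := mul_le_mul_of_nonneg_left hainv ha.le
    rwa [mul_inv_cancel₀ ha.ne'] at this
  have ht0 : 0 < a * (N : ℝ) := by linarith
  obtain ⟨b, hb, hVb⟩ := hN₀ N (le_trans (le_max_left _ _) hN)
  refine ⟨ht0, b, hb, ?_⟩
  have key := hVb (a * (N : ℝ)) ht1 le_rfl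
  rwa [Real.sqrt_eq_rpow] at key

/-- Sanity check, deliberately an `example` (the statement is item stmt-AtomisticToContinuum-9656, already proved as
`…Theorems.transferToNonBallistic_proof`; a named duplicate would only be a near-duplicate declaration): the route glue
`TransferToNonBallistic` is the composite of `windowed_bondHeat_of_lightConeBondHeat` with
`nonBallistic_of_windowed_bondHeat` — the light-cone item (S_lc) enters the NonBallistic rung only through the strictly
weaker single-time windowed hypothesis. -/
example : TransferToNonBallistic := fun hLC =>
  nonBallistic_of_windowed_bondHeat (windowed_bondHeat_of_lightConeBondHeat hLC)

end Summit.AtomisticToContinuum.FouriersLaw.Theorems.LightConeBondHeat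

end
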